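/-
Copyright (c) 2026 the pub-hodgecm-mathlib formalisation cell (harness21).  Prover seat hodgecm-mathlib-F0P3a-p03 (g14), 2026-09-01.  Road «S3-tree» (census «S3» v2
8d373588 §4 (R-T), architect A-p16 (g28)), brick T6-1u′ (CENSUS-T6 4cc46265 §0∕§4): the STABLE orbital integral of S3-id's H-side currency, along an elliptic type-(1) torus of
`H_v`, read as the sum of the two plain Bochner orbital integrals of the stable pair — the `+`-sign twin of ★ (G4) `rankOneUnstableTransfer_letter_at_of_core`'s bridge.
-/
import Literature.NumberTheory.Rogawski1990.RankOneUnstableTransferNonsplitCMOfCore   -- ★ p843033 (G4) A-p19 (g22): `compactSpace_centralizer_H_of_frame`, `normOne_frame_of_mem_centralizer`, `classOrbitalIntegral_mk_eq_integral_conj_of_isCompact_centralizer` (+ ★ `exists_setOf_isLocalStablyConjH_out_eq_pair`, ★ `localStableCentralizerEquiv`, ★ `compactSpace_centralizer_of_eigenframe_of_smul_eq`)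
import HarnessLib

/-!
# The STABLE orbital integral `Φ^st(t, f; m) = Σᶠ_{d ∼_st t} Φ(d, f; m)` of a CANONICAL family along an elliptic type-(1) torus of `H_v = U(Φ₂)(L⁺_v) × U(Φ₁)(L⁺_v)`
# is `O_ν(t, f) + O_ν(t′, f)` for ANY `t′` stably conjugate and not conjugate to `t` (Rogawski 1990 §4.1 (4.1.1), §4.3 (4.3.1); Labesse–Langlands 1979 §2)

Topic `NumberTheory/Rogawski1990`; namespace `Literature.NumberTheory.Rogawski1990`.  THEOREMS ONLY (no definition, no instance, no notation, no named fact, no `sorry`);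
kernel lane `--supports stmt-HodgeConjecture-24833`.  Cell `pub/hodgecm-mathlib` (D-0151), crux H413, line «N6nsGerm» last stub `stub_N6nsS3id`; road «S3-tree» brick
**T6-1u′** = the SOCKET ADAPTER between S3-id's H-side token `stableOrbitalIntegralRel (IsLocalStablyConjH L v) mH φH γH` (★ `LocalTransfer` :106, canonical `mH`) and the
plain-integral currency `O_ν(x, f) = ∫ f(y x y⁻¹) dν(y)` of the rank-one roads («R1LL-tree», «W′») and of ★ T6-1u `RankOneStableDepthExpansion` (this seat).  HONEST LABEL: HC_CM is
proved only modulo the printed citations (2 remaining named inputs hLiu418 24832, h413 24833) until rung 0 closes; bookkeeping over ★ material, nothing printed is asserted.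

THE MATHEMATICS (no new input; the bridge of ★ (G4) p843033 with `+` in place of `2Φ(⟦t⟧) − Σᶠ`).  Let `t₀ ∈ H_v` have `U(Φ₂)`-part regular with an ELLIPTIC eigenframe
(`t₀.1 P = P diag d`, `σ(dᵢ) dᵢ = 1`), `Z(t₀)` its (compact) torus, `Reg` a conjugation- and stably-closed regular set, `m` CANONICAL for `(Reg, ν)` (compact-core mass one), `f ∈
C_c^∞(H_v)`.  For `t ∈ Z(t₀)` with `Reg t`: (1) `t` is framed by `P` with norm-one diagonal `τ₀ ≠ τ₁` (★ `normOne_frame_of_mem_centralizer`), so `Z(t)` is compact (★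
`compactSpace_centralizer_H_of_frame`) and `Φ(⟦t⟧, f; m) = O_ν(t, f)` (★ `classOrbitalIntegral_mk_eq_integral_conj_of_isCompact_centralizer`: the canonical torus measure of a
COMPACT centraliser has total mass one); (2) the stable class of `t` is EXACTLY `{⟦t⟧, d′}` with `d′ ≠ ⟦t⟧` (★ `exists_setOf_isLocalStablyConjH_out_eq_pair`), `Reg (out d′)` by
stable closure, `Z(out d′)` compact (★ `localStableCentralizerEquiv` × the compact `U(Φ₁)_v`), so `Φ(d′, f; m) = O_ν(out d′, f)`; (3) hence
`Φ^st(t, f; m) = O_ν(t, f) + O_ν(out d′, f)`, and every `t′` stably conjugate, not conjugate, to `t` has `⟦t′⟧ = d′`, i.e. is CONJUGATE to `out d′`, so `O_ν(t′, f) = O_ν(out d′, f)`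
(right-invariance of `ν`).  With ★ T6-1u (`O_ν(↑t, φ) + O_ν(e ↑t, φ)` = full ball∕shell sums, `e ↑t` the similitude partner — stably conjugate, not conjugate) this puts the H-side
of S3-id on the type-(1) tori in closed form.

* `stableOrbitalIntegralRel_eq_integral_add_integral_of_frame` — THE ADAPTER (`Reg`-generic, as ★ (G4)).

## References
* [Rogawski1990] J. D. Rogawski, *Automorphic Representations of Unitary Groups in Three Variables*, Ann. of Math. Stud. 123 (1990): §4.1 (4.1.1) p. 39; §4.3 (4.3.1) p. 43;
  §4.9 p. 54, Lemma 4.9.3 p. 56; §3.6 pp. 31–32.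
* [LabesseLanglands1979] J.-P. Labesse, R. P. Langlands, *L-indistinguishability for SL(2)*, Canad. J. Math. 31 (1979): §2.
* [DeitmarEchterhoff2014] A. Deitmar, S. Echterhoff, *Principles of Harmonic Analysis*, 2nd ed. (2014): Cor. 1.5.4.
-/

set_option autoImplicit false

noncomputable section

open Set Filter Topology MeasureTheory NumberField IsDedekindDomain Polynomial
open scoped Matrix MatrixGroups

namespace Literature.NumberTheory.Rogawski1990

open Literature.NumberTheory.Automorphic Literature.NumberTheory.Automorphic.UnitaryGroup Literature.NumberTheory.GaloisRepresentations
open Literature.AlgebraicGeometry.ShimuraVarieties (unitaryGroup mem_unitaryGroup_iff)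

section Helpers

/-- Conjugacy in a product of groups is componentwise. [folklore] -/
private theorem isConj_prod_mk_iff_components_T6 {A B : Type*} [Group A] [Group B] {a a' : A} {b b' : B} :
    IsConj (a, b) (a', b') ↔ IsConj a a' ∧ IsConj b b' := by
  constructor
  · intro h
    exact ⟨MonoidHom.map_isConj (MonoidHom.fst A B) h, MonoidHom.map_isConj (MonoidHom.snd A B) h⟩
  · rintro ⟨ha, hb⟩
    obtain ⟨c, hc⟩ := isConj_iff.1 ha
    obtain ⟨d, hd⟩ := isConj_iff.1 hb
    exact isConj_iff.2 ⟨(c, d), by rw [Prod.mk_mul_mk, Prod.inv_mk, Prod.mk_mul_mk, hc, hd]⟩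

/-- `(X − a)(X − b)` separable ⇒ `a ≠ b`. [folklore] -/
private theorem ne_of_separable_X_sub_C_mul_T6 {K : Type*} [Field K] {a b : K} (h : ((X - C a) * (X - C b)).Separable) : a ≠ b := by
  rintro rfl
  exact Polynomial.not_isUnit_X_sub_C a (isCoprime_self.1 h.isCoprime)

/-- `![a, b]` with `a ≠ b` is injective. [folklore] -/
private theorem injective_vecCons_two_T6 {K : Type*} {a b : K} (h : a ≠ b) : Function.Injective ![a, b] := by
  intro i j hij
  fin_cases i <;> fin_cases j
  · rfl
  · exact absurd hij h
  · exact absurd hij.symm h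
  · rfl

/-- Sum over a two-element set written as `{d | p d}`. [folklore] -/
private theorem finsum_mem_eq_add_of_eq_pair_T6 {ι : Type*} {S : Set ι} {a b : ι} (hab : a ≠ b) (hS : S = {a, b}) (F : ι → ℂ) :
    (∑ᶠ i ∈ S, F i) = F a + F b := by
  rw [hS]
  exact finsum_mem_pair hab

/-- At a place with ONE prime of `L` above it, that prime is fixed by complex conjugation (local copy of ★ `smul_eq_of_subsingleton_placesOver`).
[cite: CasselsFrohlichANT1967, Ch. VII Prop. 1.2 (ii)] -/
private theorem smul_eq_of_subsingleton_placesOver_T6 (L : Type) [Field L] [NumberField L] [IsCMField L] {v : HeightOneSpectrum (𝓞 ↥(maximalRealSubfield L))}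
    (hv : Subsingleton (PlacesOver L v)) (w : PlacesOver L v) : IsCMField.complexConj L • w.1 = w.1 := by
  have hmem : (IsCMField.complexConj L • w.1).under (𝓞 ↥(maximalRealSubfield L)) = v := by
    rw [HeightOneSpectrum.under_algEquiv_smul]; exact w.2
  exact congrArg Subtype.val (Subsingleton.elim (⟨IsCMField.complexConj L • w.1, hmem⟩ : PlacesOver L v) w)

/-- The Bochner orbital integral `∫ f(y x y⁻¹) dν(y)` against a RIGHT-invariant `ν` is a class function of `x`. [cite: Rogawski1990, §4.9 p. 54] -/
private theorem integral_conj_eq_of_isConj_T6 {G : Type*} [Group G] [TopologicalSpace G] [IsTopologicalGroup G] [MeasurableSpace G] [BorelSpace G]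
    (ν : Measure G) [ν.IsMulRightInvariant] (f : G → ℂ) {x x' : G} (h : IsConj x x') :
    ∫ y, f (y * x' * y⁻¹) ∂ν = ∫ y, f (y * x * y⁻¹) ∂ν := by
  obtain ⟨c, hc⟩ := isConj_iff.1 h
  rw [← hc]
  have key : (fun y : G => f (y * (c * x * c⁻¹) * y⁻¹)) = fun y => (fun z : G => f (z * x * z⁻¹)) (y * c) := by
    funext y
    simp only [mul_inv_rev, mul_assoc]
  rw [key, integral_mul_right_eq_self (fun z : G => f (z * x * z⁻¹)) c]

end Helpers

section Adapter

variable (L : Type) [Field L] [NumberField L] [IsCMField L] (v : HeightOneSpectrum (𝓞 ↥(maximalRealSubfield L)))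

-- `L_v`-sized statement and a long composition: elaboration budget only (no search)
set_option maxHeartbeats 800000 in
/-- **THE ADAPTER — `Φ^st(t, f; m) = O_ν(t, f) + O_ν(t′, f)` ALONG AN ELLIPTIC TYPE-(1) TORUS.**  Binders as ★ (G4) `rankOneUnstableTransfer_letter_at_of_core` (non-split `v`;
Haar `ν`; `Reg` ⊆ `U(Φ₂)`-regular, conjugation- and stably closed; `m` CANONICAL for `(Reg, ν)`; `f ∈ C_c^∞(H_v)`; `t₀` with `U(Φ₂)`-part regular and an elliptic eigenframe
`(P, d)`), then `t ∈ Z(t₀)` with `Reg ↑t` and ANY `t′` stably conjugate, not conjugate, to `↑t`: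
`stableOrbitalIntegralRel (IsLocalStablyConjH L v) m f ↑t = ∫ f(y t y⁻¹) dν + ∫ f(y t′ y⁻¹) dν`.  See the module docstring for the three steps (all ★).
[cite: Rogawski1990, §4.1 (4.1.1) p. 39; §4.3 (4.3.1) p. 43; §4.9 p. 54, Lemma 4.9.3 p. 56; §3.6 pp. 31–32] [cite: LabesseLanglands1979, §2] [cite: DeitmarEchterhoff2014, Cor. 1.5.4] -/
theorem stableOrbitalIntegralRel_eq_integral_add_integral_of_frame (hv : Subsingleton (PlacesOver L v))
    [MeasurableSpace ((cmDatum L 2 (Matrix.of fun i j : Fin 2 => if i.val + j.val + 1 = 2 then (1 : L) else 0)).Local v × (cmDatum L 1 (Matrix.of fun i j : Fin 1 => if i.val + j.val + 1 = 1 then (1 : L) else 0)).Local v)] [BorelSpace ((cmDatum L 2 (Matrix.of fun i j : Fin 2 => if i.val + j.val + 1 = 2 then (1 : L) else 0)).Local v × (cmDatum L 1 (Matrix.of fun i j : Fin 1 => if i.val + j.val + 1 = 1 then (1 : L) else 0)).Local v)] (ν : Measure ((cmDatum L 2 (Matrix.of fun i j : Fin 2 => if i.val + j.val + 1 = 2 then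 (1 : L) else 0)).Local v × (cmDatum L 1 (Matrix.of fun i j : Fin 1 => if i.val + j.val + 1 = 1 then (1 : L) else 0)).Local v)) [ν.IsHaarMeasure] [ν.IsMulRightInvariant]
    [iZ : ∀ γ : ((cmDatum L 2 (Matrix.of fun i j : Fin 2 => if i.val + j.val + 1 = 2 then (1 : L) else 0)).Local v × (cmDatum L 1 (Matrix.of fun i j : Fin 1 => if i.val + j.val + 1 = 1 then (1 : L) else 0)).Local v), MeasurableSpace (((cmDatum L 2 (Matrix.of fun i j : Fin 2 => if i.val + j.val + 1 = 2 then (1 : L) else 0)).Local v × (cmDatum L 1 (Matrix.of fun i j : Fin 1 => if i.val + j.val + 1 = 1 then (1 : L) else 0)).Local v) ⧸ Subgroup.centralizer ({γ} : Set ((cmDatum L 2 (Matrix.of fun i j : Fin 2 => if i.val + j.val + 1 = 2 then (1 : L) else 0)).Local v × (cmDatum L 1 (Matrix.of fun i j : Fin 1 => if i.val + j.val + 1 = 1 then (1 : L) else 0)).Local v)))]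
    [bZ : ∀ γ : ((cmDatum L 2 (Matrix.of fun i j : Fin 2 => if i.val + j.val + 1 = 2 then (1 : L) else 0)).Local v × (cmDatum L 1 (Matrix.of fun i j : Fin 1 => if i.val + j.val + 1 = 1 then (1 : L) else 0)).Local v), BorelSpace (((cmDatum L 2 (Matrix.of fun i j : Fin 2 => if i.val + j.val + 1 = 2 then (1 : L) else 0)).Local v × (cmDatum L 1 (Matrix.of fun i j : Fin 1 => if i.val + j.val + 1 = 1 then (1 : L) else 0)).Local v) ⧸ Subgroup.centralizer ({γ} : Set ((cmDatum L 2 (Matrix.of fun i j : Fin 2 => if i.val + j.val + 1 = 2 then (1 : L) else 0)).Local v × (cmDatum L 1 (Matrix.of fun i j : Fin 1 => if i.val + j.val + 1 = 1 then (1 : L) else 0)).Local v)))]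
    (m : OrbitalMeasureFamily ((cmDatum L 2 (Matrix.of fun i j : Fin 2 => if i.val + j.val + 1 = 2 then (1 : L) else 0)).Local v × (cmDatum L 1 (Matrix.of fun i j : Fin 1 => if i.val + j.val + 1 = 1 then (1 : L) else 0)).Local v))
    (Reg : ((cmDatum L 2 (Matrix.of fun i j : Fin 2 => if i.val + j.val + 1 = 2 then (1 : L) else 0)).Local v × (cmDatum L 1 (Matrix.of fun i j : Fin 1 => if i.val + j.val + 1 = 1 then (1 : L) else 0)).Local v) → Prop) (hReg : ∀ γ, Reg γ → IsRegularElt (γ.1.val : GL (Fin 2) (LocalRing L v))) (hconj : ∀ γ x, Reg γ → Reg (x * γ * x⁻¹))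
    (hstab : ∀ γ δ, Reg γ → IsLocalStablyConjH L v γ δ → Reg δ) (hm : m.IsCanonical Reg ν)
    (f : ((cmDatum L 2 (Matrix.of fun i j : Fin 2 => if i.val + j.val + 1 = 2 then (1 : L) else 0)).Local v × (cmDatum L 1 (Matrix.of fun i j : Fin 1 => if i.val + j.val + 1 = 1 then (1 : L) else 0)).Local v) → ℂ) (hf : IsLocSmooth f)
    (t₀ : ((cmDatum L 2 (Matrix.of fun i j : Fin 2 => if i.val + j.val + 1 = 2 then (1 : L) else 0)).Local v × (cmDatum L 1 (Matrix.of fun i j : Fin 1 => if i.val + j.val + 1 = 1 then (1 : L) else 0)).Local v)) (P : GL (Fin 2) (LocalRing L v)) (d : Fin 2 → (LocalRing L v)) (ht₀ : IsRegularElt (t₀.1.val : GL (Fin 2) (LocalRing L v)))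
    (hP : (t₀.1.val.val : Matrix (Fin 2) (Fin 2) (LocalRing L v)) * P.val = P.val * Matrix.diagonal d) (hd1 : ∀ i, conjLocal L (IsCMField.complexConj L) v (d i) * d i = 1)
    (t : ↥(Subgroup.centralizer ({t₀} : Set ((cmDatum L 2 (Matrix.of fun i j : Fin 2 => if i.val + j.val + 1 = 2 then (1 : L) else 0)).Local v × (cmDatum L 1 (Matrix.of fun i j : Fin 1 => if i.val + j.val + 1 = 1 then (1 : L) else 0)).Local v)))) (hRt : Reg (t : ((cmDatum L 2 (Matrix.of fun i j : Fin 2 => if i.val + j.val + 1 = 2 then (1 : L) else 0)).Local v × (cmDatum L 1 (Matrix.of fun i j : Fin 1 => if i.val + j.val + 1 = 1 then (1 : L) else 0)).Local v)))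
    (t' : ((cmDatum L 2 (Matrix.of fun i j : Fin 2 => if i.val + j.val + 1 = 2 then (1 : L) else 0)).Local v × (cmDatum L 1 (Matrix.of fun i j : Fin 1 => if i.val + j.val + 1 = 1 then (1 : L) else 0)).Local v)) (hst : IsLocalStablyConjH L v (t : ((cmDatum L 2 (Matrix.of fun i j : Fin 2 => if i.val + j.val + 1 = 2 then (1 : L) else 0)).Local v × (cmDatum L 1 (Matrix.of fun i j : Fin 1 => if i.val + j.val + 1 = 1 then (1 : L) else 0)).Local v)) t') (hnc : ¬ IsConj (t : ((cmDatum L 2 (Matrix.of fun i j : Fin 2 => if i.val + j.val + 1 = 2 then (1 : L) else 0)).Local v × (cmDatum L 1 (Matrix.of fun i j : Fin 1 => if i.val + j.val + 1 = 1 then (1 : L) else 0)).Local v)) t') :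
    stableOrbitalIntegralRel (IsLocalStablyConjH L v) m f (t : ((cmDatum L 2 (Matrix.of fun i j : Fin 2 => if i.val + j.val + 1 = 2 then (1 : L) else 0)).Local v × (cmDatum L 1 (Matrix.of fun i j : Fin 1 => if i.val + j.val + 1 = 1 then (1 : L) else 0)).Local v)) = (∫ y, f (y * (t : ((cmDatum L 2 (Matrix.of fun i j : Fin 2 => if i.val + j.val + 1 = 2 then (1 : L) else 0)).Local v × (cmDatum L 1 (Matrix.of fun i j : Fin 1 => if i.val + j.val + 1 = 1 then (1 : L) else 0)).Local v)) * y⁻¹) ∂ν) + ∫ y, f (y * t' * y⁻¹) ∂ν := by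
  classical
  obtain ⟨w⟩ := PlacesOver.nonempty L v
  have hw : IsCMField.complexConj L • w.1 = w.1 := smul_eq_of_subsingleton_placesOver_T6 L hv w
  letI : Field (LocalRing L v) := (LocalRing.isField_of_smul_eq (IsCMField.complexConj L) (IsCMField.complexConj_ne_one L) w hw).toField
  have hΦd : ((Matrix.of fun i j : Fin 2 => if i.val + j.val + 1 = 2 then (1 : L) else 0)).det ≠ 0 := (isUnit_antidiagOne_det (L := L) (N := 2)).ne_zero
  -- the frame of `t`, its regularity, its compact centraliser
  have hregt : IsRegularElt ((t : ((cmDatum L 2 (Matrix.of fun i j : Fin 2 => if i.val + j.val + 1 = 2 then (1 : L) else 0)).Local v × (cmDatum L 1 (Matrix.of fun i j : Fin 1 => if i.val + j.val + 1 = 1 then (1 : L) else 0)).Local v)).1.val : GL (Fin 2) (LocalRing L v)) := hReg _ hRt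
  obtain ⟨hτ1, hframe⟩ := normOne_frame_of_mem_centralizer L v w hw t₀ P d ht₀ hP hd1 (t : ((cmDatum L 2 (Matrix.of fun i j : Fin 2 => if i.val + j.val + 1 = 2 then (1 : L) else 0)).Local v × (cmDatum L 1 (Matrix.of fun i j : Fin 1 => if i.val + j.val + 1 = 1 then (1 : L) else 0)).Local v)) t.2
  have hτ01 : ((P⁻¹).val * ((t : ((cmDatum L 2 (Matrix.of fun i j : Fin 2 => if i.val + j.val + 1 = 2 then (1 : L) else 0)).Local v × (cmDatum L 1 (Matrix.of fun i j : Fin 1 => if i.val + j.val + 1 = 1 then (1 : L) else 0)).Local v)).1.val.val : Matrix (Fin 2) (Fin 2) (LocalRing L v)) * P.val) 0 0 ≠ ((P⁻¹).val * ((t : ((cmDatum L 2 (Matrix.of fun i j : Fin 2 => if i.val + j.val + 1 = 2 then (1 : L) else 0)).Local v × (cmDatum L 1 (Matrix.of fun i j : Fin 1 => if i.val + j.val + 1 = 1 then (1 : L) else 0)).Local v)).1.val.val : Matrix (Fin 2) (Fin 2) (LocalRing L v)) * P.val) 1 1 := by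
    have hsep : (finCharpolyTwo L v (t : ((cmDatum L 2 (Matrix.of fun i j : Fin 2 => if i.val + j.val + 1 = 2 then (1 : L) else 0)).Local v × (cmDatum L 1 (Matrix.of fun i j : Fin 1 => if i.val + j.val + 1 = 1 then (1 : L) else 0)).Local v))).Separable := hregt
    rw [finCharpolyTwo_eq_of_frame P hframe] at hsep
    exact ne_of_separable_X_sub_C_mul_T6 hsep
  have hτinj := injective_vecCons_two_T6 hτ01
  have hZt := compactSpace_centralizer_H_of_frame L v w hw (t : ((cmDatum L 2 (Matrix.of fun i j : Fin 2 => if i.val + j.val + 1 = 2 then (1 : L) else 0)).Local v × (cmDatum L 1 (Matrix.of fun i j : Fin 1 => if i.val + j.val + 1 = 1 then (1 : L) else 0)).Local v)) P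
    ![((P⁻¹).val * ((t : ((cmDatum L 2 (Matrix.of fun i j : Fin 2 => if i.val + j.val + 1 = 2 then (1 : L) else 0)).Local v × (cmDatum L 1 (Matrix.of fun i j : Fin 1 => if i.val + j.val + 1 = 1 then (1 : L) else 0)).Local v)).1.val.val : Matrix (Fin 2) (Fin 2) (LocalRing L v)) * P.val) 0 0, ((P⁻¹).val * ((t : ((cmDatum L 2 (Matrix.of fun i j : Fin 2 => if i.val + j.val + 1 = 2 then (1 : L) else 0)).Local v × (cmDatum L 1 (Matrix.of fun i j : Fin 1 => if i.val + j.val + 1 = 1 then (1 : L) else 0)).Local v)).1.val.val : Matrix (Fin 2) (Fin 2) (LocalRing L v)) * P.val) 1 1] hframe hτinj hτ1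
  -- the partner class: the stable class of `t` is `{⟦t⟧, d′}` (★ p842188)
  obtain ⟨d', hd'ne, hset₀⟩ := exists_setOf_isLocalStablyConjH_out_eq_pair L w hw (h := (t : ((cmDatum L 2 (Matrix.of fun i j : Fin 2 => if i.val + j.val + 1 = 2 then (1 : L) else 0)).Local v × (cmDatum L 1 (Matrix.of fun i j : Fin 1 => if i.val + j.val + 1 = 1 then (1 : L) else 0)).Local v))) hframe hτinj hτ1
  -- re-read the set equality in this file's spelling of `Quotient.out`
  have hset : {d : ConjClasses ((cmDatum L 2 (Matrix.of fun i j : Fin 2 => if i.val + j.val + 1 = 2 then (1 : L) else 0)).Local v × (cmDatum L 1 (Matrix.of fun i j : Fin 1 => if i.val + j.val + 1 = 1 then (1 : L) else 0)).Local v) | IsLocalStablyConjH L v (t : ((cmDatum L 2 (Matrix.of fun i j : Fin 2 => if i.val + j.val + 1 = 2 then (1 : L) else 0)).Local v × (cmDatum L 1 (Matrix.of fun i j : Fin 1 => if i.val + j.val + 1 = 1 then (1 : L) else 0)).Local v)) (Quotient.out d)} = {ConjClasses.mk (t : ((cmDatum L 2 (Matrix.of fun i j : Fin 2 => if i.val +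 j.val + 1 = 2 then (1 : L) else 0)).Local v × (cmDatum L 1 (Matrix.of fun i j : Fin 1 => if i.val + j.val + 1 = 1 then (1 : L) else 0)).Local v)), d'} := hset₀
  have hout : ∀ c : ConjClasses ((cmDatum L 2 (Matrix.of fun i j : Fin 2 => if i.val + j.val + 1 = 2 then (1 : L) else 0)).Local v × (cmDatum L 1 (Matrix.of fun i j : Fin 1 => if i.val + j.val + 1 = 1 then (1 : L) else 0)).Local v), ConjClasses.mk (Quotient.out c) = c := fun c => by rw [← ConjClasses.quotient_mk_eq_mk, Quotient.out_eq]
  have hstc : ∀ {a b : ((cmDatum L 2 (Matrix.of fun i j : Fin 2 => if i.val + j.val + 1 = 2 then (1 : L) else 0)).Local v × (cmDatum L 1 (Matrix.of fun i j : Fin 1 => if i.val + j.val + 1 = 1 then (1 : L) else 0)).Local v)}, IsConj a b → IsLocalStablyConjH L v a b := by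
    intro a b hab
    obtain ⟨h1, h2⟩ := isConj_prod_mk_iff_components_T6.1 (show IsConj (a.1, a.2) (b.1, b.2) from hab)
    exact ⟨isStablyConj_of_isConj h1, isStablyConj_of_isConj h2⟩
  have hst' : IsLocalStablyConjH L v (t : ((cmDatum L 2 (Matrix.of fun i j : Fin 2 => if i.val + j.val + 1 = 2 then (1 : L) else 0)).Local v × (cmDatum L 1 (Matrix.of fun i j : Fin 1 => if i.val + j.val + 1 = 1 then (1 : L) else 0)).Local v)) (Quotient.out d') := by
    have h : d' ∈ {d : ConjClasses ((cmDatum L 2 (Matrix.of fun i j : Fin 2 => if i.val + j.val + 1 = 2 then (1 : L) else 0)).Local v × (cmDatum L 1 (Matrix.of fun i j : Fin 1 => if i.val + j.val + 1 = 1 then (1 : L) else 0)).Local v) | IsLocalStablyConjH L v (t : ((cmDatum L 2 (Matrix.of fun i j : Fin 2 => if i.val + j.val + 1 = 2 then (1 : L) else 0)).Local v × (cmDatum L 1 (Matrix.of fun i j : Fin 1 => if i.val + j.val + 1 = 1 then (1 : L) else 0)).Local v)) (Quotient.out d)} := by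
      rw [hset]; exact Set.mem_insert_of_mem _ (Set.mem_singleton d')
    exact h
  have hRt' : Reg (Quotient.out d') := hstab _ _ hRt hst'
  -- `t′` lies in the class `d′`
  have hmem : ConjClasses.mk t' ∈ {d : ConjClasses ((cmDatum L 2 (Matrix.of fun i j : Fin 2 => if i.val + j.val + 1 = 2 then (1 : L) else 0)).Local v × (cmDatum L 1 (Matrix.of fun i j : Fin 1 => if i.val + j.val + 1 = 1 then (1 : L) else 0)).Local v) | IsLocalStablyConjH L v (t : ((cmDatum L 2 (Matrix.of fun i j : Fin 2 => if i.val + j.val + 1 = 2 then (1 : L) else 0)).Local v × (cmDatum L 1 (Matrix.of fun i j : Fin 1 => if i.val + j.val + 1 = 1 then (1 : L) else 0)).Local v)) (Quotient.out d)} :=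
    hst.trans (hstc (ConjClasses.mk_eq_mk_iff_isConj.1 (hout (ConjClasses.mk t')).symm))
  have hd't : ConjClasses.mk t' = d' := by
    rw [hset] at hmem
    rcases hmem with h | h
    · exact absurd (ConjClasses.mk_eq_mk_iff_isConj.1 h).symm hnc
    · exact h
  have hconj' : IsConj (Quotient.out d') t' := by
    rw [← ConjClasses.mk_eq_mk_iff_isConj, hout d', hd't]
  -- `Z(out d′)` is compact too: `Z((out d′).1) ≃ₜ* Z(t.1)` along the stable conjugacy, `Z((out d′).2) ⊆ U(Φ₁)_v` compact
  have hZt' : CompactSpace ↥(Subgroup.centralizer ({(Quotient.out d' : ((cmDatum L 2 (Matrix.of fun i j : Fin 2 => if i.val + j.val + 1 = 2 then (1 : L) else 0)).Local v × (cmDatum L 1 (Matrix.of fun i j : Fin 1 => if i.val + j.val + 1 = 1 then (1 : L) else 0)).Local v))} : Set ((cmDatum L 2 (Matrix.of fun i j : Fin 2 => if i.val + j.val + 1 = 2 then (1 : L) else 0)).Local v × (cmDatum L 1 (Matrix.of fun i j : Fin 1 => if i.val + j.val + 1 = 1 then (1 : L) else 0)).Local v))) := by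
    have hΦh : (((Matrix.of fun i j : Fin 2 => if i.val + j.val + 1 = 2 then (1 : L) else 0)).map (cmConjRingHom L))ᵀ = (Matrix.of fun i j : Fin 2 => if i.val + j.val + 1 = 2 then (1 : L) else 0) := by
      ext i j; fin_cases i <;> fin_cases j <;> simp [Matrix.of_apply]
    haveI : CompactSpace ↥(Subgroup.centralizer ({(t : ((cmDatum L 2 (Matrix.of fun i j : Fin 2 => if i.val + j.val + 1 = 2 then (1 : L) else 0)).Local v × (cmDatum L 1 (Matrix.of fun i j : Fin 1 => if i.val + j.val + 1 = 1 then (1 : L) else 0)).Local v)).1} : Set ((cmDatum L 2 (Matrix.of fun i j : Fin 2 => if i.val + j.val + 1 = 2 then (1 : L) else 0)).Local v))) :=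
      compactSpace_centralizer_of_eigenframe_of_smul_eq L w hw _ hΦh hΦd (t : ((cmDatum L 2 (Matrix.of fun i j : Fin 2 => if i.val + j.val + 1 = 2 then (1 : L) else 0)).Local v × (cmDatum L 1 (Matrix.of fun i j : Fin 1 => if i.val + j.val + 1 = 1 then (1 : L) else 0)).Local v)).1 hframe hτinj hτ1
    haveI hZ1 : CompactSpace ↥(Subgroup.centralizer ({(Quotient.out d' : ((cmDatum L 2 (Matrix.of fun i j : Fin 2 => if i.val + j.val + 1 = 2 then (1 : L) else 0)).Local v × (cmDatum L 1 (Matrix.of fun i j : Fin 1 => if i.val + j.val + 1 = 1 then (1 : L) else 0)).Local v)).1} : Set ((cmDatum L 2 (Matrix.of fun i j : Fin 2 => if i.val + j.val + 1 = 2 then (1 : L) else 0)).Local v))) :=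
      (localStableCentralizerEquiv L v (N := 2) hΦd hΦd hst'.1 hregt).toHomeomorph.compactSpace
    haveI : CompactSpace ((cmDatum L 1 (Matrix.of fun i j : Fin 1 => if i.val + j.val + 1 = 1 then (1 : L) else 0)).Local v) := compactSpace_cmDatum_local_one_of_smul_eq L _ w hw
    have hZ1' : IsCompact ((Subgroup.centralizer ({(Quotient.out d' : ((cmDatum L 2 (Matrix.of fun i j : Fin 2 => if i.val + j.val + 1 = 2 then (1 : L) else 0)).Local v × (cmDatum L 1 (Matrix.of fun i j : Fin 1 => if i.val + j.val + 1 = 1 then (1 : L) else 0)).Local v)).1} : Set ((cmDatum L 2 (Matrix.of fun i j : Fin 2 => if i.val + j.val + 1 = 2 then (1 : L) else 0)).Local v)) : Subgroup ((cmDatum L 2 (Matrix.of fun i j : Fin 2 => if i.val + j.val + 1 = 2 then (1 : L) else 0)).Local v)) : Set ((cmDatum L 2 (Matrix.of fun i j : Fin 2 => if i.val + j.val + 1 = 2 then (1 : L) else 0)).Local v)) :=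
      isCompact_iff_compactSpace.2 hZ1
    have hZ2 : IsCompact ((Subgroup.centralizer ({(Quotient.out d' : ((cmDatum L 2 (Matrix.of fun i j : Fin 2 => if i.val + j.val + 1 = 2 then (1 : L) else 0)).Local v × (cmDatum L 1 (Matrix.of fun i j : Fin 1 => if i.val + j.val + 1 = 1 then (1 : L) else 0)).Local v)).2} : Set ((cmDatum L 1 (Matrix.of fun i j : Fin 1 => if i.val + j.val + 1 = 1 then (1 : L) else 0)).Local v)) : Subgroup ((cmDatum L 1 (Matrix.of fun i j : Fin 1 => if i.val + j.val + 1 = 1 then (1 : L) else 0)).Local v)) : Set ((cmDatum L 1 (Matrix.of fun i j : Fin 1 => if i.val + j.val + 1 = 1 then (1 : L) else 0)).Local v)) :=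
      (isClosed_coe_centralizer_singleton (Quotient.out d' : ((cmDatum L 2 (Matrix.of fun i j : Fin 2 => if i.val + j.val + 1 = 2 then (1 : L) else 0)).Local v × (cmDatum L 1 (Matrix.of fun i j : Fin 1 => if i.val + j.val + 1 = 1 then (1 : L) else 0)).Local v)).2).isCompact
    refine isCompact_iff_compactSpace.1 ?_
    have hprod : ((Subgroup.centralizer ({(Quotient.out d' : ((cmDatum L 2 (Matrix.of fun i j : Fin 2 => if i.val + j.val + 1 = 2 then (1 : L) else 0)).Local v × (cmDatum L 1 (Matrix.of fun i j : Fin 1 => if i.val + j.val + 1 = 1 then (1 : L) else 0)).Local v))} : Set ((cmDatum L 2 (Matrix.of fun i j : Fin 2 => if i.val + j.val + 1 = 2 then (1 : L) else 0)).Local v × (cmDatum L 1 (Matrix.of fun i j : Fin 1 => if i.val + j.val + 1 = 1 then (1 : L) else 0)).Local v)) : Subgroup ((cmDatum L 2 (Matrix.of fun i j : Fin 2 => if i.val + j.val + 1 = 2 then (1 : L) else 0)).Local v × (cmDatum L 1 (Matrix.of fun i j : Fin 1 => if i.val + j.val + 1 = 1 then (1 : L) else 0)).Local v)) : Set ((cmDatum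 L 2 (Matrix.of fun i j : Fin 2 => if i.val + j.val + 1 = 2 then (1 : L) else 0)).Local v × (cmDatum L 1 (Matrix.of fun i j : Fin 1 => if i.val + j.val + 1 = 1 then (1 : L) else 0)).Local v)) =
        ((Subgroup.centralizer ({(Quotient.out d' : ((cmDatum L 2 (Matrix.of fun i j : Fin 2 => if i.val + j.val + 1 = 2 then (1 : L) else 0)).Local v × (cmDatum L 1 (Matrix.of fun i j : Fin 1 => if i.val + j.val + 1 = 1 then (1 : L) else 0)).Local v)).1} : Set ((cmDatum L 2 (Matrix.of fun i j : Fin 2 => if i.val + j.val + 1 = 2 then (1 : L) else 0)).Local v)) : Subgroup ((cmDatum L 2 (Matrix.of fun i j : Fin 2 => if i.val + j.val + 1 = 2 then (1 : L) else 0)).Local v)) : Set ((cmDatum L 2 (Matrix.of fun i j : Fin 2 => if i.val + j.val + 1 = 2 then (1 : L) else 0)).Local v)) ×ˢ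
          ((Subgroup.centralizer ({(Quotient.out d' : ((cmDatum L 2 (Matrix.of fun i j : Fin 2 => if i.val + j.val + 1 = 2 then (1 : L) else 0)).Local v × (cmDatum L 1 (Matrix.of fun i j : Fin 1 => if i.val + j.val + 1 = 1 then (1 : L) else 0)).Local v)).2} : Set ((cmDatum L 1 (Matrix.of fun i j : Fin 1 => if i.val + j.val + 1 = 1 then (1 : L) else 0)).Local v)) : Subgroup ((cmDatum L 1 (Matrix.of fun i j : Fin 1 => if i.val + j.val + 1 = 1 then (1 : L) else 0)).Local v)) : Set ((cmDatum L 1 (Matrix.of fun i j : Fin 1 => if i.val + j.val + 1 = 1 then (1 : L) else 0)).Local v)) := by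
      ext z
      simp only [SetLike.mem_coe, Subgroup.mem_centralizer_singleton_iff, Set.mem_prod, Prod.ext_iff, Prod.fst_mul, Prod.snd_mul]
    rw [hprod]
    exact hZ1'.prod hZ2
  -- canonical ⇒ Bochner at both classes
  have hΦt := classOrbitalIntegral_mk_eq_integral_conj_of_isCompact_centralizer L v ν hconj hm f hf.continuous (t : ((cmDatum L 2 (Matrix.of fun i j : Fin 2 => if i.val + j.val + 1 = 2 then (1 : L) else 0)).Local v × (cmDatum L 1 (Matrix.of fun i j : Fin 1 => if i.val + j.val + 1 = 1 then (1 : L) else 0)).Local v)) hRt hZt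
  have hΦt' := classOrbitalIntegral_mk_eq_integral_conj_of_isCompact_centralizer L v ν hconj hm f hf.continuous (Quotient.out d') hRt' hZt'
  rw [hout d'] at hΦt'
  -- assemble
  rw [stableOrbitalIntegralRel_def, finsum_mem_eq_add_of_eq_pair_T6 hd'ne.symm hset, hΦt, hΦt', integral_conj_eq_of_isConj_T6 ν f hconj']

end Adapter

end Literature.NumberTheory.Rogawski1990

end
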